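import Summits.CriticalPhenomena.CardyFormulaZ2.Theorems.CardyComplexConeDefs
import Summits.CriticalPhenomena.CardyFormulaZ2.Theorems.CardyComplexConeCoherentMoreraPairingBound
import Summits.CriticalPhenomena.CardyFormulaZ2.Theorems.CardyComplexConeCoherentMoreraTraceIdentityAux
import Summits.CriticalPhenomena.CardyFormulaZ2.Theorems.ParafermionPrecompact.Negative.ParafermionPrecompactFalseOfBulkNondegenerate
import Literature.Probability.LatticeModels.DartPhase
import Literature.Probability.LatticeModels.MedialWindingBridge

/-!
# Stub `stub_siteRegrouping` of line `finitary-green-pairing`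
(crux `CoherentMorera`, stmt-CriticalPhenomena-11388)

**Site regrouping.** Under the trace identity on compacts (hypothesis `TraceIdentityOn D Λ`), for
every test function `φ` of the Dobrushin domain `D` the crux's VERTEX pairing
`P_V(δ) = Σ_z F_δ(z) ∂̄φ(z_δ)` and the `A₀` SITE pairing `P₀(δ) = Σ_v A₀(v) ∂̄φ(δv)` are
`δ^{5/3}`-null together: `ScaledNull (PV Λ φ) ↔ ScaledNull (P0 Λ φ)`.

Proof.
1. *Edges only*: the exploration path visits lattice edges only
   (`mem_edgeSet_of_mem_medialExploration`, unconditional), so `F_δ` vanishes at the junk pairs of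
   `Sym2 (Site 2)` and `P_V` is a finite sum over the lattice edges `s(x, x + eᵢ)` (`(x, i)` unique)
   whose medial point meets `tsupport φ` (`∂̄φ = 0` off `tsupport φ`).
2. *Trace identity* on `K := tsupport φ`: eventually `2cos(π/12) F_δ(s(x, x + eᵢ)) = Σ_k E_δ(…)`.
3. *Regrouping by corners* (`SiteRegrouping.regrouping_bound`, deterministic): each corner
   `(v, v − off)` is carried by exactly two lattice edges (its source and its target edge), both
   with medial point at distance `δ/2` from `δv`; the edge sum with every test point moved to the
   corner's own site is exactly `P₀` for the horizontal edges and again `P₀` for the vertical ones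
   (a translation of two of the four partial sums by `e₀`, resp. `e₁`). Moving the test points
   costs `|E_δ| · Lip(∂̄φ) · δ/2` per incidence (`|E_δ| ≤ 1`; `∂̄φ` is Lipschitz for `φ ∈ C_c^∞`),
   over the `≤ (2R+5)²/δ²` sites of a box: `‖2cos(π/12) P_V(δ) − 2 P₀(δ)‖ ≤ 4 L (2R+5)² / δ`.
4. Hence `δ^{5/3} (2cos(π/12) P_V − 2 P₀) = O(δ^{2/3}) → 0`, and `2cos(π/12) ≠ 0` gives the `↔`.
-/
namespace Summit.CriticalPhenomena.CardyFormulaZ2.Cruxes.CoherentMorera.FinitaryGreenPairing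

open MeasureTheory Filter Set Metric Complex
open scoped Topology BigOperators
open Literature.Probability.LatticeModels
open Literature.Probability.RandomPlanarGeometry (DobrushinDomain)
open Summit.CriticalPhenomena.CardyFormulaZ2.Theorems.ParafermionPrecompact.Negative
  (passageSum_medialExploration_eq_zero exists_eq_mk_add_single)

noncomputable section

namespace SiteRegrouping

/-! ## The observables: edges only, `|E_δ| ≤ 1` -/

/-- `F_δ` vanishes at the pairs of `Sym2 (Site 2)` that are not lattice edges (the exploration path
visits lattice edges only; no admissibility needed). -/
theorem vertexObs_eq_zero_of_not_mem_edgeSet (Λ : ℝ → DiscreteDobrushin) (δ : ℝ)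
    {z : MedialVertex} (hz : z ∉ (zdGraph 2).edgeSet) : vertexObs Λ δ z = 0 := by
  simp only [vertexObs, passageSum_medialExploration_eq_zero δ (1 / 3) hz, integral_zero]

/-- The crux integrand `cornerPhase` is the named dart phase sum of `DartPhase.lean`. -/
theorem cornerPhase_eq_dartPhaseSum (δ : ℝ) (E : DiscreteDobrushin) (v f : Site 2)
    (ω : Literature.Probability.Percolation.BondConfig (Site 2)) :
    cornerPhase δ E v f ω = Parafermion.dartPhaseSum (medialExploration E ω) δ (1 / 3) (v, f) := by
  unfold cornerPhase Parafermion.dartPhaseSum -- buildfix 2026-08-20: two `winding` copies, bridge them: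
  rw [Literature.Probability.LatticeModels.Polyline.winding_eq_winding']; refine Finset.sum_congr rfl fun k _ => ?_
  congr 1
  push_cast
  ring

/-- `|E_δ(c)| ≤ 1` for every family, mesh and corner (at most one unimodular phase under a
probability measure). -/
theorem norm_cornerObs_le_one (Λ : ℝ → DiscreteDobrushin) (δ : ℝ) (c : Site 2 × Site 2) :
    ‖cornerObs Λ δ c‖ ≤ 1 := by
  have : cornerObs Λ δ c = Parafermion.bondDartObservable (Λ δ) δ (1 / 3) c := by
    simp only [cornerObs, cornerPhase_eq_dartPhaseSum, Parafermion.bondDartObservable_def]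
  rw [this]
  exact Parafermion.norm_bondDartObservable_le_one _ _ _ _

/-! ## The test function: `∂̄φ` is Lipschitz and vanishes off `tsupport φ` -/

/-- `∂̄φ = 0` off `tsupport φ`. -/
theorem dbar_eq_zero_of_notMem {φ : ℂ → ℂ} {p : ℂ} (hp : p ∉ tsupport φ) : dbar φ p = 0 := by
  simp [dbar, fderiv_of_notMem_tsupport ℝ hp]

/-- For `φ ∈ C_c^∞`, `∂̄φ` is globally Lipschitz. -/
theorem dbar_lipschitz {φ : ℂ → ℂ} (hφ : ContDiff ℝ (⊤ : ℕ∞) φ) (hc : HasCompactSupport φ) :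
    ∃ L : ℝ, 0 ≤ L ∧ ∀ p q : ℂ, ‖dbar φ p - dbar φ q‖ ≤ L * ‖p - q‖ := by
  have h2 : ContDiff ℝ 2 φ := contDiff_infty.mp hφ 2
  have h1 : ContDiff ℝ 1 (fderiv ℝ φ) := h2.fderiv_right (by norm_num)
  obtain ⟨C, hC⟩ := h1.lipschitzWith_of_hasCompactSupport (hc.fderiv ℝ) one_ne_zero
  refine ⟨C, C.coe_nonneg, fun p q => ?_⟩
  have hu : ∀ u : ℂ, ‖u‖ = 1 → ‖fderiv ℝ φ p u - fderiv ℝ φ q u‖ ≤ C * ‖p - q‖ := by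
    intro u hu
    rw [← sub_apply]
    refine ((fderiv ℝ φ p - fderiv ℝ φ q).le_opNorm u).trans ?_
    rw [hu, mul_one]
    exact hC.norm_sub_le p q
  have hI' : ‖I * (fderiv ℝ φ p I - fderiv ℝ φ q I)‖ ≤ C * ‖p - q‖ := by
    rw [norm_mul, norm_I, one_mul]
    exact hu I norm_I
  have : dbar φ p - dbar φ q =
      ((fderiv ℝ φ p 1 - fderiv ℝ φ q 1) + I * (fderiv ℝ φ p I - fderiv ℝ φ q I)) / 2 := by
    simp only [dbar]
    ring
  rw [this, norm_div, Complex.norm_two]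
  linarith [hu 1 norm_one, norm_add_le (fderiv ℝ φ p 1 - fderiv ℝ φ q 1)
    (I * (fderiv ℝ φ p I - fderiv ℝ φ q I))]

/-! ## Lattice bookkeeping -/

/-- A lattice edge `s(x, x + eᵢ)` determines `(x, i)`. -/
theorem edge_eq_edge {x x' : Site 2} {i i' : Fin 2}
    (h : (s(x, x + Pi.single i 1) : MedialVertex) = s(x', x' + Pi.single i' 1)) :
    x = x' ∧ i = i' := by
  have hs : (Pi.single i' (1:ℤ) : Site 2) i = 1 ∨ (Pi.single i' (1:ℤ) : Site 2) i = 0 := by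
    rw [Pi.single_apply]
    split_ifs <;> simp
  rcases Sym2.eq_iff.1 h with ⟨h1, h2⟩ | ⟨h1, h2⟩
  · subst h1
    refine ⟨rfl, ?_⟩
    have h3 := congrFun (add_left_cancel h2) i
    rw [Pi.single_eq_same, Pi.single_apply] at h3
    by_contra hne
    rw [if_neg hne] at h3
    exact one_ne_zero h3
  · exfalso
    have h3 := congrFun h1 i
    have h4 := congrFun h2 i
    simp only [Pi.add_apply, Pi.single_eq_same] at h3 h4
    omega

/-- Sites whose mesh point is within `1` of the ball of radius `R` lie in the box of half-width
`⌈(R+1)/δ⌉₊`. -/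
theorem mem_box_of_near {δ R : ℝ} (hδ : 0 < δ) {v : Site 2} {w : ℂ} (hw : ‖w‖ ≤ 1)
    (hvw : ‖meshPoint δ v + w‖ ≤ R) :
    v ∈ ((Finset.Icc (-(⌈(R + 1) / δ⌉₊ : ℤ)) ⌈(R + 1) / δ⌉₊) ×ˢ
      (Finset.Icc (-(⌈(R + 1) / δ⌉₊ : ℤ)) ⌈(R + 1) / δ⌉₊)).image
      (fun q : ℤ × ℤ => (![q.1, q.2] : Site 2)) := by
  have h1 : ‖meshPoint δ v‖ ≤ R + 1 := by
    calc ‖meshPoint δ v‖ = ‖(meshPoint δ v + w) - w‖ := by rw [add_sub_cancel_right]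
      _ ≤ ‖meshPoint δ v + w‖ + ‖w‖ := norm_sub_le _ _
      _ ≤ R + 1 := add_le_add hvw hw
  have hcoord : ∀ c : ℤ, |δ * c| ≤ R + 1 → |c| ≤ ((⌈(R + 1) / δ⌉₊ : ℕ) : ℤ) := by
    intro c hcδ
    rw [abs_mul, abs_of_pos hδ] at hcδ
    have : (|c| : ℝ) ≤ (⌈(R + 1) / δ⌉₊ : ℕ) := by
      refine le_trans ?_ (Nat.le_ceil _)
      rw [le_div_iff₀ hδ, mul_comm]
      exact hcδ
    exact_mod_cast this
  apply mem_box
  · exact hcoord _ (le_trans (by rw [← meshPoint_re]; exact abs_re_le_norm _) h1)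
  · exact hcoord _ (le_trans (by rw [← meshPoint_im]; exact abs_im_le_norm _) h1)

/-! ## The deterministic regrouping estimate -/

/-- **Regrouping by corners.** Let `∂̄φ` be `L`-Lipschitz with `tsupport φ ⊆ closedBall 0 R`,
`0 < δ ≤ 1`, `G` a corner function bounded by `1` and `F` a function of medial vertices vanishing
off the lattice edges and obeying the trace identity `c · F(s(x, x + eᵢ)) = Σ_k G(cornersAt x i k)`
at every lattice edge whose medial point lies in `tsupport φ`. Then
`‖c · Σ_z F(z) ∂̄φ(z_δ) − 2 · pair0 G φ δ‖ ≤ 4 L (2R+5)² / δ`: each corner `(v, v − off)` is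
carried by exactly two lattice edges, at medial distance `δ/2` from `δv`, and the edge sum with
every test point moved to the corner's site is `pair0 G φ δ` for each of the two directions
(translation of two partial sums by `e₀`, resp. `e₁`). -/
theorem regrouping_bound {φ : ℂ → ℂ} {L R : ℝ} (hL : 0 ≤ L)
    (hLip : ∀ p q : ℂ, ‖dbar φ p - dbar φ q‖ ≤ L * ‖p - q‖) (hRpos : 0 < R)
    (hR : ∀ p ∈ tsupport φ, ‖p‖ ≤ R) {δ : ℝ} (hδ : 0 < δ) (hδ1 : δ ≤ 1)
    {G : Site 2 × Site 2 → ℂ} (hG : ∀ c, ‖G c‖ ≤ 1) {F : MedialVertex → ℂ} {c : ℂ}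
    (hF0 : ∀ z, z ∉ (zdGraph 2).edgeSet → F z = 0)
    (hFG : ∀ (x : Site 2) (i : Fin 2), medialPoint δ s(x, x + Pi.single i 1) ∈ tsupport φ →
      c * F s(x, x + Pi.single i 1) = ∑ k : Fin 4, G (cornersAt x i k)) :
    ‖c * ∑ᶠ z : MedialVertex, F z * dbar φ (medialPoint δ z) - 2 * pair0 G φ δ‖ ≤
      4 * L * (2 * R + 5) ^ 2 / δ := by
  classical
  -- the box of contributing sites
  set N : ℕ := ⌈(R + 1) / δ⌉₊ with hN
  have hNlt : (N : ℝ) < (R + 1) / δ + 1 := Nat.ceil_lt_add_one (by positivity)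
  set B : Finset (Site 2) := ((Finset.Icc (-(N : ℤ)) N) ×ˢ (Finset.Icc (-(N : ℤ)) N)).image
    (fun q : ℤ × ℤ => (![q.1, q.2] : Site 2)) with hB
  have hcard : (B.card : ℝ) * δ ^ 2 ≤ (2 * R + 5) ^ 2 := by
    have h1 : (B.card : ℝ) ≤ (2 * N + 1) ^ 2 := by exact_mod_cast card_box_le N
    have h2 : (N : ℝ) * δ < R + 1 + δ := by
      have := mul_lt_mul_of_pos_right hNlt hδ
      rwa [add_mul, div_mul_cancel₀ _ hδ.ne', one_mul] at this
    have h3 : (2 * (N : ℝ) + 1) * δ ≤ 2 * R + 5 := by nlinarith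
    have h4 : 0 ≤ (2 * (N : ℝ) + 1) * δ := by positivity
    calc (B.card : ℝ) * δ ^ 2 ≤ (2 * N + 1) ^ 2 * δ ^ 2 := by gcongr
      _ = ((2 * (N : ℝ) + 1) * δ) ^ 2 := by ring
      _ ≤ (2 * R + 5) ^ 2 := by gcongr
  -- the test function factor `ψ` and its support
  set ψ : ℂ → ℂ := dbar φ with hψ
  have hψB : ∀ (v : Site 2) (w : ℂ), ‖w‖ ≤ 1 → ψ (meshPoint δ v + w) ≠ 0 → v ∈ B := by
    intro v w hw h0
    refine mem_box_of_near hδ hw (hR _ ?_)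
    by_contra hn
    exact h0 (dbar_eq_zero_of_notMem hn)
  have hψ0 : ∀ v : Site 2, ψ (meshPoint δ v) ≠ 0 → v ∈ B := fun v h0 =>
    hψB v 0 (by simp) (by rwa [add_zero])
  have htr : ∀ (β : Site 2 → ℂ) (e : Site 2), Function.support β ⊆ ↑B →
      Function.support (fun x => β (x + e)) ⊆ ↑B → ∑ x ∈ B, β (x + e) = ∑ v ∈ B, β v := by
    intro β e s s'
    rw [← finsum_eq_sum_of_support_subset _ s, ← finsum_eq_sum_of_support_subset _ s']
    exact finsum_comp_equiv (Equiv.addRight e)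
  -- the offsets
  set η : ℝ := δ / 2 with hη
  have nδ : ‖(δ : ℂ)‖ = δ := by rw [norm_real, Real.norm_eq_abs, abs_of_pos hδ]
  have nη : ‖(η : ℂ)‖ = δ / 2 := by
    rw [norm_real, Real.norm_eq_abs, hη, abs_of_pos (by positivity)]
  have nηδ : ‖(η : ℂ) - δ‖ = δ / 2 := by
    rw [← Complex.ofReal_sub, norm_real, Real.norm_eq_abs, hη,
      show δ / 2 - δ = -(δ / 2) by ring, abs_neg, abs_of_pos (by positivity)]
  -- per-site quantities: the edge terms `T` at `x`, and the site-shifted terms `H`, `V`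
  obtain ⟨T, hT⟩ : ∃ T : Site 2 → ℂ, ∀ x, T x =
      (G (x, x) + G (x + e0, x) + G (x + e0, x - e1) + G (x, x - e1)) * ψ (meshPoint δ x + η)
      + (G (x + e1, x - e0) + G (x + e1, x) + G (x, x) + G (x, x - e0)) *
        ψ (meshPoint δ x + η * I) := ⟨_, fun _ => rfl⟩
  obtain ⟨H, hH⟩ : ∃ H : Site 2 → ℂ, ∀ x, H x = (G (x, x) + G (x, x - e1)) * ψ (meshPoint δ x)
      + (G (x + e0, x) + G (x + e0, x - e1)) * ψ (meshPoint δ x + δ) := ⟨_, fun _ => rfl⟩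
  obtain ⟨V, hV⟩ : ∃ V : Site 2 → ℂ, ∀ x, V x =
      (G (x + e1, x - e0) + G (x + e1, x)) * ψ (meshPoint δ x + δ * I)
      + (G (x, x) + G (x, x - e0)) * ψ (meshPoint δ x) := ⟨_, fun _ => rfl⟩
  -- (A) the site pairing as a box sum
  have hP : pair0 G φ δ = ∑ v ∈ B, A0 G v * ψ (meshPoint δ v) := by
    refine finsum_eq_sum_of_support_subset _ fun v hv => ?_
    exact hψ0 v fun h0 => hv (mul_eq_zero_of_right _ h0)
  -- (B) the two regroupings: test points at the sites give `pair0` for each direction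
  have hI1 : ∑ x ∈ B, H x = ∑ v ∈ B, A0 G v * ψ (meshPoint δ v) := by
    set β : Site 2 → ℂ := fun v => (G (v, v - e0) + G (v, v - e0 - e1)) * ψ (meshPoint δ v)
      with hβ
    have hβx : ∀ x, β (x + e0) = (G (x + e0, x) + G (x + e0, x - e1)) * ψ (meshPoint δ x + δ) :=
      fun x => by simp only [hβ, add_sub_cancel_right, meshPoint_add_e0]
    have hβs : ∑ x ∈ B, β (x + e0) = ∑ v ∈ B, β v := by
      refine htr β e0 (fun v hv => hψ0 v fun h0 => hv ?_) (fun x hx => ?_)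
      · simp only [hβ, h0, mul_zero]
      · refine hψB x δ (nδ.le.trans hδ1) fun h0 => hx ?_
        simp only [hβx, h0, mul_zero]
    calc _ = ∑ x ∈ B, ((G (x, x) + G (x, x - e1)) * ψ (meshPoint δ x) + β (x + e0)) := by
          simp only [hH, hβx]
      _ = ∑ v ∈ B, ((G (v, v) + G (v, v - e1)) * ψ (meshPoint δ v) + β v) := by
          rw [Finset.sum_add_distrib, hβs, Finset.sum_add_distrib]
      _ = _ := Finset.sum_congr rfl fun v _ => by simp only [hβ, A0]; ring
  have hI2 : ∑ x ∈ B, V x = ∑ v ∈ B, A0 G v * ψ (meshPoint δ v) := by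
    set κ : Site 2 → ℂ := fun v => (G (v, v - e0 - e1) + G (v, v - e1)) * ψ (meshPoint δ v)
      with hκ
    have he : ∀ x : Site 2, x + e1 - e0 - e1 = x - e0 := fun x => by abel
    have hκx : ∀ x, κ (x + e1) =
        (G (x + e1, x - e0) + G (x + e1, x)) * ψ (meshPoint δ x + δ * I) :=
      fun x => by simp only [hκ, he, add_sub_cancel_right, meshPoint_add_e1]
    have hκs : ∑ x ∈ B, κ (x + e1) = ∑ v ∈ B, κ v := by
      refine htr κ e1 (fun v hv => hψ0 v fun h0 => hv ?_) (fun x hx => ?_)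
      · simp only [hκ, h0, mul_zero]
      · refine hψB x (δ * I) (by rw [norm_mul, nδ, norm_I, mul_one]; exact hδ1) fun h0 => hx ?_
        simp only [hκx, h0, mul_zero]
    calc _ = ∑ x ∈ B, (κ (x + e1) + (G (x, x) + G (x, x - e0)) * ψ (meshPoint δ x)) := by
          simp only [hV, hκx]
      _ = ∑ v ∈ B, (κ v + (G (v, v) + G (v, v - e0)) * ψ (meshPoint δ v)) := by
          rw [Finset.sum_add_distrib, hκs, Finset.sum_add_distrib]
      _ = _ := Finset.sum_congr rfl fun v _ => by simp only [hκ, A0]; ring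
  -- (C) the vertex sum as a box sum, through the trace identity
  obtain ⟨edge, hedge⟩ : ∃ edge : Site 2 × Fin 2 → MedialVertex,
      ∀ p, edge p = s(p.1, p.1 + Pi.single p.2 1) := ⟨_, fun _ => rfl⟩
  have hinj : Set.InjOn edge ↑(B ×ˢ (Finset.univ : Finset (Fin 2))) := by
    rintro ⟨x, i⟩ - ⟨x', i'⟩ - h
    rw [hedge, hedge] at h
    obtain ⟨h1, h2⟩ := edge_eq_edge h
    exact Prod.ext h1 h2
  have hsupp : Function.support (fun z => F z * ψ (medialPoint δ z)) ⊆
      ↑((B ×ˢ (Finset.univ : Finset (Fin 2))).image edge) := by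
    intro z hz
    have hψz : ψ (medialPoint δ z) ≠ 0 := fun h => hz (by simp only [h, mul_zero])
    have hze : z ∈ (zdGraph 2).edgeSet := by
      by_contra hn
      exact hz (by simp only [hF0 z hn, zero_mul])
    obtain ⟨x, i, rfl⟩ := exists_eq_mk_add_single hze
    have hw : ‖medialPoint δ s(x, x + Pi.single i 1) - meshPoint δ x‖ = δ / 2 := by
      rw [← dist_eq_norm, dist_comm]
      exact TraceIdentity.dist_meshPoint_medialPoint hδ.le (Sym2.mem_mk_left _ _)
    have hxB : x ∈ B := by
      refine hψB x (medialPoint δ s(x, x + Pi.single i 1) - meshPoint δ x)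
        (by rw [hw]; linarith) ?_
      rwa [add_sub_cancel]
    rw [Finset.coe_image]
    exact ⟨(x, i), by simp [hxB], (hedge _).trans rfl⟩
  have key : ∀ (x : Site 2) (i : Fin 2),
      c * (F (edge (x, i)) * ψ (medialPoint δ (edge (x, i)))) =
        (∑ k : Fin 4, G (cornersAt x i k)) * ψ (medialPoint δ s(x, x + Pi.single i 1)) := by
    intro x i
    simp only [hedge]
    by_cases h0 : ψ (medialPoint δ s(x, x + Pi.single i 1)) = 0
    · rw [h0, mul_zero, mul_zero, mul_zero]
    · rw [← mul_assoc, hFG x i (not_not.1 fun hn => h0 (dbar_eq_zero_of_notMem hn))]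
  have hS : c * ∑ᶠ z : MedialVertex, F z * ψ (medialPoint δ z) = ∑ x ∈ B, T x := by
    rw [finsum_eq_sum_of_support_subset _ hsupp, Finset.sum_image hinj, Finset.sum_product,
      Finset.mul_sum]
    refine Finset.sum_congr rfl fun x _ => ?_
    rw [Fin.sum_univ_two, mul_add, key x 0, key x 1, Fin.sum_univ_four, Fin.sum_univ_four,
      medialPoint_horizontal, medialPoint_vertical, hT]
    simp [cornersAt, hη]
  -- (D) per-site error of moving the test points to the sites
  have pair_le : ∀ (g₁ g₂ a b : ℂ), ‖g₁‖ ≤ 1 → ‖g₂‖ ≤ 1 → ‖a - b‖ = δ / 2 →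
      ‖(g₁ + g₂) * (ψ a - ψ b)‖ ≤ L * δ := by
    intro g₁ g₂ a b h1 h2 hab
    rw [norm_mul]
    calc ‖g₁ + g₂‖ * ‖ψ a - ψ b‖ ≤ (1 + 1) * (L * ‖a - b‖) :=
          mul_le_mul (norm_add_le_of_le h1 h2) (hLip a b) (norm_nonneg _) (by norm_num)
      _ = L * δ := by rw [hab]; ring
  have hper : ∀ x ∈ B, ‖T x - (H x + V x)‖ ≤ 4 * L * δ := by
    intro x _
    rw [hT, hH, hV]
    set p : ℂ := meshPoint δ x
    have hA := pair_le (G (x, x)) (G (x, x - e1)) (p + η) p (hG _) (hG _)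
      (by rw [add_sub_cancel_left, nη])
    have hB' := pair_le (G (x + e0, x)) (G (x + e0, x - e1)) (p + η) (p + δ) (hG _) (hG _)
      (by rw [add_sub_add_left_eq_sub, nηδ])
    have hC := pair_le (G (x + e1, x - e0)) (G (x + e1, x)) (p + η * I) (p + δ * I) (hG _)
      (hG _) (by rw [add_sub_add_left_eq_sub, ← sub_mul, norm_mul, nηδ, norm_I, mul_one])
    have hD := pair_le (G (x, x)) (G (x, x - e0)) (p + η * I) p (hG _) (hG _)
      (by rw [add_sub_cancel_left, norm_mul, nη, norm_I, mul_one])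
    calc _ = ‖((G (x, x) + G (x, x - e1)) * (ψ (p + η) - ψ p)
          + (G (x + e0, x) + G (x + e0, x - e1)) * (ψ (p + η) - ψ (p + δ)))
          + ((G (x + e1, x - e0) + G (x + e1, x)) * (ψ (p + η * I) - ψ (p + δ * I))
          + (G (x, x) + G (x, x - e0)) * (ψ (p + η * I) - ψ p))‖ := by
          congr 1
          ring
      _ ≤ (L * δ + L * δ) + (L * δ + L * δ) :=
          norm_add_le_of_le (norm_add_le_of_le hA hB') (norm_add_le_of_le hC hD)
      _ = 4 * L * δ := by ring
  calc ‖c * ∑ᶠ z : MedialVertex, F z * ψ (medialPoint δ z) - 2 * pair0 G φ δ‖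
      = ‖∑ x ∈ B, (T x - (H x + V x))‖ := by
        rw [Finset.sum_sub_distrib, Finset.sum_add_distrib, hS, hP, two_mul, hI1, hI2]
    _ ≤ ∑ x ∈ B, 4 * L * δ := norm_sum_le_of_le _ hper
    _ = B.card * (4 * L * δ) := by rw [Finset.sum_const, nsmul_eq_mul]
    _ ≤ 4 * L * (2 * R + 5) ^ 2 / δ := by
        rw [le_div_iff₀ hδ]
        calc (B.card : ℝ) * (4 * L * δ) * δ = ((B.card : ℝ) * δ ^ 2) * (4 * L) := by ring
          _ ≤ (2 * R + 5) ^ 2 * (4 * L) := by gcongr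
          _ = 4 * L * (2 * R + 5) ^ 2 := by ring

/-- `s^{2/3} → 0` as `s → 0⁺`. -/
theorem tendsto_rpow_twoThirds : Tendsto (fun s : ℝ => s ^ ((2:ℝ) / 3)) (𝓝[>] (0:ℝ)) (𝓝 0) := by
  have h := (Real.continuousAt_rpow_const 0 ((2:ℝ) / 3) (Or.inr (by norm_num))).tendsto
  rw [Real.zero_rpow (by norm_num)] at h
  exact h.mono_left nhdsWithin_le_nhds

end SiteRegrouping

open SiteRegrouping

/-! ## The stub -/

/-- STUB `stub_siteRegrouping` — **site regrouping**: under the trace identity on compacts, for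
every test function of `D` the vertex pairing `P_V` and the `A₀` site pairing `P₀` are
`δ^{5/3}`-null together. Eventually in `δ`, `‖2cos(π/12)·P_V(δ) − 2·P₀(δ)‖ ≤ C/δ`
(`SiteRegrouping.regrouping_bound` with `G = E_δ`, `F = F_δ` and the trace identity on
`K = tsupport φ`), so `δ^{5/3}(2cos(π/12) P_V − 2 P₀) → 0`, and `2cos(π/12) ≠ 0`. (The guards are
not needed: the trace identity is the hypothesis, and `F_δ` vanishes off the lattice edges for every
datum.) -/
theorem stub_siteRegrouping : Sig.stub_siteRegrouping := by
  rintro D Λ - hTI φ ⟨hφ, hc, hsub⟩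
  obtain ⟨L, hL, hLip⟩ := dbar_lipschitz hφ hc
  obtain ⟨R, hRpos, hR⟩ := hc.isCompact.isBounded.exists_pos_norm_le
  set c : ℂ := ((2 * Real.cos (Real.pi / 12) : ℝ) : ℂ) with hcdef
  have hc0 : c ≠ 0 := by
    have := Real.cos_pos_of_mem_Ioo (x := Real.pi / 12)
      ⟨by linarith [Real.pi_pos], by linarith [Real.pi_pos]⟩
    exact Complex.ofReal_ne_zero.2 (by positivity)
  set C : ℝ := 4 * L * (2 * R + 5) ^ 2
  have hbd : ∀ᶠ δ in 𝓝[>] (0:ℝ), ‖c * PV Λ φ δ - 2 * P0 Λ φ δ‖ ≤ C / δ := by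
    filter_upwards [hTI (tsupport φ) hc.isCompact hsub, Ioc_mem_nhdsGT one_pos] with δ hti hδI
    exact regrouping_bound hL hLip hRpos hR hδI.1 hδI.2 (norm_cornerObs_le_one Λ δ)
      (fun z hz => vertexObs_eq_zero_of_not_mem_edgeSet Λ δ hz) hti
  have hdiff : Tendsto (fun δ : ℝ => ((δ ^ ((5:ℝ) / 3) : ℝ) : ℂ) * (c * PV Λ φ δ - 2 * P0 Λ φ δ))
      (𝓝[>] (0:ℝ)) (𝓝 0) := by
    have hup : ∀ᶠ δ in 𝓝[>] (0:ℝ),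
        ‖((δ ^ ((5:ℝ) / 3) : ℝ) : ℂ) * (c * PV Λ φ δ - 2 * P0 Λ φ δ)‖ ≤ C * δ ^ ((2:ℝ) / 3) := by
      filter_upwards [hbd, (eventually_mem_nhdsWithin : ∀ᶠ δ in 𝓝[>] (0:ℝ), δ ∈ Ioi 0)]
        with δ hb hδ
      rw [Set.mem_Ioi] at hδ
      rw [norm_mul, Complex.norm_real, Real.norm_eq_abs, abs_of_nonneg (Real.rpow_nonneg hδ.le _)]
      calc δ ^ ((5:ℝ) / 3) * ‖c * PV Λ φ δ - 2 * P0 Λ φ δ‖ ≤ δ ^ ((5:ℝ) / 3) * (C / δ) :=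
            mul_le_mul_of_nonneg_left hb (Real.rpow_nonneg hδ.le _)
        _ = C * (δ ^ ((5:ℝ) / 3) / δ) := by ring
        _ = C * δ ^ ((2:ℝ) / 3) := by
            rw [show (2:ℝ) / 3 = 5 / 3 - 1 by norm_num, Real.rpow_sub_one hδ.ne']
    have hlim : Tendsto (fun δ : ℝ => C * δ ^ ((2:ℝ) / 3)) (𝓝[>] (0:ℝ)) (𝓝 0) := by
      simpa using tendsto_rpow_twoThirds.const_mul C
    rw [tendsto_zero_iff_norm_tendsto_zero]
    exact squeeze_zero' (Eventually.of_forall fun δ => norm_nonneg _) hup hlim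
  constructor
  · intro hPV
    have h := ((hPV.const_mul c).sub hdiff).const_mul (1 / 2 : ℂ)
    rw [mul_zero, sub_zero, mul_zero] at h
    refine h.congr' (Eventually.of_forall fun δ => ?_)
    simp only [P0]
    ring
  · intro hP0
    have h := (hdiff.add ((hP0.const_mul 2))).const_mul c⁻¹
    rw [mul_zero, zero_add, mul_zero] at h
    refine h.congr' (Eventually.of_forall fun δ => ?_)
    simp only [P0]
    field_simp
    ring

end

end Summit.CriticalPhenomena.CardyFormulaZ2.Cruxes.CoherentMorera.FinitaryGreenPairing
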